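import Mathlib
import HarnessLib
import Summits.Ventures.LatticeQCDFlow.Exactness.SphereLatticePolynomialPoincare

/-!
# Norm equivalence: on lattice polynomials of degree `≤ N` the Dirichlet form of Lüscher's operator is comparable to the `L²(π)`-distance from the constants, `(d−1)‖f − c₀‖² ≤ Σ_k ∫‖∂̃_k f‖² ≤ N(N+d−2)‖f − c₀‖²`; the order-`k` flow generator is `L²`-comparable to the fluctuation of the order-`k` flow action, uniformly in the volume

HONEST FRAMING: exact (Metropolis-corrected) sampling algorithms for lattice gauge theory;
figures of merit are autocorrelation/cost numbers at stated couplings and volumes; no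
continuum-physics claim.

Venture `LatticeQCDFlow` (cell pub-lqcd), topic `Exactness`; FANOUT row 7 (`s0-cpn-null`: the
S0-D1 rung — 2D CP⁹, Lüscher's LO trivializing map inside HMC, Engel–Schaefer 2011).  NEW WORK of
the cell over the tree's `Exactness/SphereLatticePolynomialPoincare.lean` (`poincare_polyS`),
`Exactness/SphereLatticeLaplacianSelfAdjoint.lean` (`bernstein_polyS`),
`Exactness/SphereLuscherSeriesUniqueness.lean` (`siteGrad` ignores additive constants) and
`Exactness/SphereLuscherSeriesSolver.lean` (`solverTerm`, the explicit Lüscher series); nothing is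
cited as a fact.  Printed counterpart, NAMED ONLY: M. Lüscher, Commun. Math. Phys. 293 (2010) 899,
§3.3 and §4.2 (the generator `T = −∂S̃` of the trivializing flow); Engel–Schaefer, Comput. Phys.
Commun. 182 (2011) 2107, §3 eqs. (14)–(16) (`T_n = −∂̃_n S̃`).

## Content (`d = dim E ≥ 2`; `Λ` finite nonempty; `Ω = S(E)^Λ`, `π = ⊗_Λ volume.toSphere`)

* `siteGrad_sub_const` — `∂̃_k (f − c) = ∂̃_k f` on `Ω`; `sub_const_mem_polyS`.
* **`dirichlet_norm_equivalence_polyS`** — THE SHARPENED SANDWICH WITH ONE AND THE SAME CONSTANT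
  SHIFT: for every `f ∈ polyS N` there is `c₀` with
  `(d−1) ∫ (f − c₀)² dπ ≤ Σ_k ∫ ‖∂̃_k f‖² dπ ≤ N(N + d − 2) ∫ (f − c₀)² dπ` — the Dirichlet form of
  `𝔏₀` and the squared `L²(π)`-distance from the constants are EQUIVALENT NORMS on `polyS N` modulo
  constants, with constants `d − 1` and `N(N + d − 2)` independent of `Λ` (both optimal by
  `SphereLatticeSolidHarmonics`).
* **`luscher_generator_norm_equivalence`** — for the explicit Lüscher series `T⁽ᵏ⁾ = solverTerm k` of
  any polynomial action of degree `≤ a` (generator `T⁽ᵏ⁾_n = −∂̃_n T⁽ᵏ⁾`):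
  `(d−1) ∫ (T⁽ᵏ⁾ − c)² ≤ Σ_n ∫ ‖∂̃_n T⁽ᵏ⁾‖² ≤ a(k+1)(a(k+1)+d−2) ∫ (T⁽ᵏ⁾ − c)²`;
  **`luscher_generator_norm_equivalence_esAction`** — Engel–Schaefer: constants `d − 1` and
  `2(k+1)(2k+d)` at order `k`: THE `L²(π)` SIZE OF THE ORDER-`k` FLOW GENERATOR IS COMPARABLE TO THE
  `L²(π)` FLUCTUATION OF THE ORDER-`k` FLOW ACTION, UNIFORMLY IN THE VOLUME.

NOT CLAIMED: sup-norm or pointwise bounds on the generator; anything at flow time `t > 0`; numbers.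
-/

noncomputable section

namespace Summit.Ventures.LatticeQCDFlow.Exactness

open Function Set Metric MeasureTheory
open scoped RealInnerProductSpace

variable {Λ : Type*} {E : Type*} [NormedAddCommGroup E] [InnerProductSpace ℝ E]
  [FiniteDimensional ℝ E] [MeasurableSpace E] [BorelSpace E]
variable [Fintype Λ] [DecidableEq Λ]

/-! ## §1 The Dirichlet form is a norm modulo constants on `polyS N`, with volume-independent constants -/

section Equivalence

omit [MeasurableSpace E] [BorelSpace E] [Fintype Λ] [DecidableEq Λ] in
/-- Shifting by a constant stays in `polyS N`. -/
theorem sub_const_mem_polyS {N : ℕ} {f : (Λ → E) → ℝ} (hf : f ∈ polyS Λ E N) (c : ℝ) :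
    (fun x => f x - c) ∈ polyS Λ E N :=
  (polyS Λ E N).sub_mem hf (const_mem_polyS N c)

omit [MeasurableSpace E] [BorelSpace E] [Fintype Λ] in
/-- **`∂̃_k` does not see additive constants**: `∂̃_k (f − c) = ∂̃_k f` on the spheres. -/
theorem siteGrad_sub_const (f : (Λ → E) → ℝ) (c : ℝ) (ξ : Λ → sphere (0 : E) 1) (k : Λ) :
    siteGrad k (fun x => f x - c) (fun n => (ξ n : E)) = siteGrad k f (fun n => (ξ n : E)) := by
  refine siteGrad_eq_of_forall_eq_add_const (c := -c) (fun ξ' => ?_) ξ k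
  ring

/-- **NORM EQUIVALENCE ON `polyS N` MODULO CONSTANTS.**  For every lattice polynomial `f` of degree
`≤ N` there is a constant `c₀` with
`(d − 1) ∫ (f − c₀)² dπ ≤ Σ_k ∫ ‖∂̃_k f‖² dπ ≤ N (N + d − 2) ∫ (f − c₀)² dπ` (`dim E ≥ 2`):
the same shift `c₀` on both sides, constants independent of `Λ`. -/
theorem dirichlet_norm_equivalence_polyS (h2 : 2 ≤ Module.finrank ℝ E) {N : ℕ} {f : (Λ → E) → ℝ}
    (hf : f ∈ polyS Λ E N) : ∃ c₀ : ℝ,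
      ((Module.finrank ℝ E : ℝ) - 1) *
          ∫ ω, (f (fun n => ((ω : Λ → sphere (0 : E) 1) n : E)) - c₀) ^ 2
            ∂Measure.pi (fun _ : Λ => (volume : Measure E).toSphere) ≤
        ∑ k, ∫ ω, ‖siteGrad k f (fun n => ((ω : Λ → sphere (0 : E) 1) n : E))‖ ^ 2
          ∂Measure.pi (fun _ : Λ => (volume : Measure E).toSphere) ∧
      ∑ k, ∫ ω, ‖siteGrad k f (fun n => ((ω : Λ → sphere (0 : E) 1) n : E))‖ ^ 2
          ∂Measure.pi (fun _ : Λ => (volume : Measure E).toSphere) ≤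
        (N : ℝ) * (N + (Module.finrank ℝ E : ℝ) - 2) *
          ∫ ω, (f (fun n => ((ω : Λ → sphere (0 : E) 1) n : E)) - c₀) ^ 2
            ∂Measure.pi (fun _ : Λ => (volume : Measure E).toSphere) := by
  haveI : Nontrivial E := Module.nontrivial_of_finrank_pos (R := ℝ) (by omega)
  obtain ⟨c₀, hlow⟩ := poincare_polyS h2 hf
  refine ⟨c₀, hlow, ?_⟩
  -- Bernstein for `f − c₀ ∈ polyS N`, whose natural gradients are those of `f`
  have hB := bernstein_polyS (Λ := Λ) N (sub_const_mem_polyS hf c₀)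
  simp_rw [siteGrad_sub_const] at hB
  exact hB

end Equivalence

/-! ## §2 The order-`k` flow generator is `L²`-comparable to the order-`k` flow action -/

section Generator

/-- **GENERATOR–ACTION NORM EQUIVALENCE, every order, every polynomial action.**  For the explicit
Lüscher series `T⁽ᵏ⁾ = solverTerm hS k` of an action `S ∈ polyS a` (`Λ` nonempty, `dim E ≥ 2`) there
is a constant `c` with `(d−1) ∫ (T⁽ᵏ⁾ − c)² dπ ≤ Σ_n ∫ ‖∂̃_n T⁽ᵏ⁾‖² dπ ≤ a(k+1)(a(k+1)+d−2) ∫ (T⁽ᵏ⁾ − c)² dπ`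
— the squared `L²(π)` norm of the order-`k` generator `T⁽ᵏ⁾_n = −∂̃_n T⁽ᵏ⁾` against the fluctuation of
the order-`k` flow action. -/
theorem luscher_generator_norm_equivalence (h2 : 2 ≤ Module.finrank ℝ E) {a : ℕ}
    {S : (Λ → E) → ℝ} (hS : S ∈ polyS Λ E a) (k : ℕ) : ∃ c : ℝ,
      ((Module.finrank ℝ E : ℝ) - 1) *
          ∫ ω, (solverTerm hS k (fun n => ((ω : Λ → sphere (0 : E) 1) n : E)) - c) ^ 2
            ∂Measure.pi (fun _ : Λ => (volume : Measure E).toSphere) ≤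
        ∑ n, ∫ ω, ‖-siteGrad n (solverTerm hS k) (fun m => ((ω : Λ → sphere (0 : E) 1) m : E))‖ ^ 2
          ∂Measure.pi (fun _ : Λ => (volume : Measure E).toSphere) ∧
      ∑ n, ∫ ω, ‖-siteGrad n (solverTerm hS k) (fun m => ((ω : Λ → sphere (0 : E) 1) m : E))‖ ^ 2
          ∂Measure.pi (fun _ : Λ => (volume : Measure E).toSphere) ≤
        ((a * (k + 1) : ℕ) : ℝ) * ((a * (k + 1) : ℕ) + (Module.finrank ℝ E : ℝ) - 2) *
          ∫ ω, (solverTerm hS k (fun n => ((ω : Λ → sphere (0 : E) 1) n : E)) - c) ^ 2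
            ∂Measure.pi (fun _ : Λ => (volume : Measure E).toSphere) := by
  simp_rw [norm_neg]
  exact dirichlet_norm_equivalence_polyS h2 (solverTerm_mem hS k)

/-- **ENGEL–SCHAEFER**: at order `k` the constants are `d − 1` and `2(k+1)(2k+d)` — the `L²(π)` size of
the order-`k` CP(N−1)/O(N) flow generator is comparable to the `L²(π)` fluctuation of the order-`k`
flow action, UNIFORMLY IN THE VOLUME (any couplings `U`). -/
theorem luscher_generator_norm_equivalence_esAction (h2 : 2 ≤ Module.finrank ℝ E) (κ S₀ : ℝ)
    (U : Λ → Λ → (E →L[ℝ] E)) (k : ℕ) : ∃ c : ℝ,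
      ((Module.finrank ℝ E : ℝ) - 1) *
          ∫ ω, (solverTerm (esAction_mem_polyS κ S₀ U) k
              (fun n => ((ω : Λ → sphere (0 : E) 1) n : E)) - c) ^ 2
            ∂Measure.pi (fun _ : Λ => (volume : Measure E).toSphere) ≤
        ∑ n, ∫ ω, ‖-siteGrad n (solverTerm (esAction_mem_polyS κ S₀ U) k)
            (fun m => ((ω : Λ → sphere (0 : E) 1) m : E))‖ ^ 2
          ∂Measure.pi (fun _ : Λ => (volume : Measure E).toSphere) ∧
      ∑ n, ∫ ω, ‖-siteGrad n (solverTerm (esAction_mem_polyS κ S₀ U) k)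
            (fun m => ((ω : Λ → sphere (0 : E) 1) m : E))‖ ^ 2
          ∂Measure.pi (fun _ : Λ => (volume : Measure E).toSphere) ≤
        (2 * (k + 1) : ℝ) * (2 * k + (Module.finrank ℝ E : ℝ)) *
          ∫ ω, (solverTerm (esAction_mem_polyS κ S₀ U) k
              (fun n => ((ω : Λ → sphere (0 : E) 1) n : E)) - c) ^ 2
            ∂Measure.pi (fun _ : Λ => (volume : Measure E).toSphere) := by
  obtain ⟨c, h1, h2'⟩ := luscher_generator_norm_equivalence h2 (esAction_mem_polyS κ S₀ U) k
  refine ⟨c, h1, ?_⟩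
  have e : ((2 * (k + 1) : ℕ) : ℝ) * ((2 * (k + 1) : ℕ) + (Module.finrank ℝ E : ℝ) - 2) =
      (2 * (k + 1) : ℝ) * (2 * k + (Module.finrank ℝ E : ℝ)) := by
    push_cast; ring
  rw [e] at h2'
  exact h2'

end Generator

end Summit.Ventures.LatticeQCDFlow.Exactness

end
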